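import Literature.FieldTheory.Kummer.KummerFiniteRank
import Mathlib.LinearAlgebra.Basis.VectorSpace
import HarnessLib

/-!
# Quadratic Kummer extensions: the sign characters of `Gal(L(√c₁, …, √c_k)/L)`, Galois transport of
# polynomial relations among square roots, and the spanning lemma

Layer `Literature/FieldTheory/Kummer`, namespace `Literature.FieldTheory.Kummer`. Sequel of
`KummerFiniteRank.lean` (Lang, *Algebra* VI §8: the Kummer field `E = L(y₁, …, y_k)`, `yᵢⁿ = cᵢ ∈ Lˣ`,
is Galois over `L` and `σ(yᵢ) = ζ^{aᵢ(σ)} yᵢ`) in the QUADRATIC case `n = 2`, `ζ = -1`: for a field `L`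
in which `-1` is a primitive square root of unity (i.e. `char L ≠ 2`), an extension `Ω` and elements
`y₁, …, y_k ∈ Ω` with `yᵢ² = cᵢ ∈ Lˣ`, every `L`-automorphism `σ` of `E = L(y₁, …, y_k)` acts on the
generators by SIGNS, `σ(yᵢ) = εᵢ(σ) yᵢ`, `εᵢ(σ) = σ(yᵢ)/yᵢ = ±1`.

This is the piece of Galois theory behind H. Imai's computation of the Hodge group of a product of
elliptic curves with complex multiplication (*On the Hodge groups of some abelian varieties*, Kōdai Math.
Sem. Rep. 27 (1976), Proposition, first case, p. 368: "As `H` is defined over `Q`, `h^σ ∈ H` for all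
`h ∈ H` and for all `σ ∈ Aut(C)`. Take primes `p₁, …, p_s` which devide some `dᵢ` and take `σ ∈ Aut(C)`
such that `σ(√p_j) = -√p_j` […] `φᵢ(z)^σ = φᵢ(z)^{εᵢ}` where `εᵢ = ±1`"), used by
`Literature/Geometry/Kaehler/ComplexTorusHodgeGroupPiCMEllipticCurves.lean`; Imai's prime-by-prime induction
is replaced here by the Galois group of the multiquadratic field itself (Lang VI §8, Thm. 8.1) and
Dedekind's independence of characters (Lang VI §4, Thm. 4.1 = Mathlib `linearIndependent_monoidHom`).

## Contents (theorems only; no definition, no named fact)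

For `hζ : IsPrimitiveRoot (-1 : L) 2`, `y : Fin k → Ω`, `c : Fin k → L`, `cᵢ ≠ 0`, `yᵢ² = cᵢ`,
`E = kummerField L y`, `σ : E ≃ₐ[L] E`:
* `coe_algEquiv_gen_eq_or_eq_neg` — **`σ(yᵢ) = yᵢ` or `σ(yᵢ) = -yᵢ`**; `algEquiv_gen_div_sq`
  (`(σ(yᵢ)/yᵢ)² = 1`), `algEquiv_gen_div_eq_one_or` (`σ(yᵢ)/yᵢ = ±1`), `algEquiv_gen_div_mul`
  (`ε(στ) = ε(σ) ε(τ)`), `one_gen_div` (`ε(1) = 1`);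
* **`aeval_algEquiv_gen_eq_zero`** — GALOIS TRANSPORT: if `f ∈ L[u₁, …, u_k]` vanishes at `(y₁, …, y_k)`
  then it vanishes at `(σ(y₁), …, σ(y_k)) = (ε₁(σ)y₁, …, ε_k(σ)y_k)` for every `σ`;
* `finiteDimensional_kummerField_two`, and (with `KummerFiniteRank.isGalois_kummerField`)
  **`exists_algEquiv_gen_div_ne`** — DISTINCTNESS: if `yᵢ yⱼ ∉ L` then the sign characters `εᵢ`, `εⱼ`
  differ at some `σ` (Galois correspondence: an element fixed by every `σ` lies in `L`); conversely
  `algEquiv_gen_div_eq_of_mul_mem` (`yᵢ yⱼ ∈ L ⇒ εᵢ = εⱼ`) and `algEquiv_gen_div_eq_one_of_mem`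
  (`yᵢ ∈ L ⇒ εᵢ = 1`);
* **`exists_eq_sum_mul_algEquiv_gen_div`** — SPANNING: if `yᵢ yⱼ ∉ L` for all `i ≠ j`, then for every
  `θ : Fin k → Ω` there are `φ_σ ∈ Ω` with `θᵢ = ∑_σ φ_σ εᵢ(σ)` for all `i` (the vectors
  `ε(σ) ∈ {±1}ᵏ ⊂ Ωᵏ`, `σ ∈ Gal(E/L)`, span `Ωᵏ`: the `εᵢ` are pairwise distinct characters of the finite
  group `Gal(E/L)`, hence linearly independent functions on it).
* The case `L = ℚ`, `Ω = ℝ`: `Rat.isPrimitiveRoot_neg_one_two`.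

## References
* [Lang2002] S. Lang, *Algebra*, 3rd ed., GTM 211, Springer 2002, VI §8 Thm. 8.1 (Kummer theory),
  VI §4 Thm. 4.1 (independence of characters), VI §1 Thm. 1.8 (Galois correspondence).
* [Imai1976HodgeGroups] H. Imai, *On the Hodge groups of some abelian varieties*, Kōdai Math. Sem. Rep. 27 (1976)
  367–372, §2 Proposition (proof, first case), p. 368.
-/

noncomputable section

open IntermediateField

namespace Literature.FieldTheory.Kummer

section Quadratic

variable {L Ω : Type*} [Field L] [Field Ω] [Algebra L Ω]
variable {k : ℕ} (hζ : IsPrimitiveRoot (-1 : L) 2)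
variable (y : Fin k → Ω) (c : Fin k → L) (hc : ∀ i, c i ≠ 0)
  (hy : ∀ i, y i ^ 2 = algebraMap L Ω (c i))

include hc hy in
/-- The generators of a quadratic Kummer field are non-zero. [cite: Lang2002, VI §8] -/
theorem gen_ne_zero_two (i : Fin k) : y i ≠ 0 :=
  gen_ne_zero (n := 2) y c hc hy two_pos i

include hζ in
/-- `-1 ≠ 1` in `Ω` when `-1` is a PRIMITIVE square root of unity in `L` (i.e. `char L ≠ 2`; Kummer theory
of exponent `n` assumes a primitive `n`-th root of unity in the base). [cite: Lang2002, VI §8 (hypotheses of Thm 8.1: "`m` prime to the characteristic … a primitive `m`-th root of unity")] -/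
theorem neg_one_ne_one_of_isPrimitiveRoot : (-1 : Ω) ≠ 1 := by
  intro h
  apply hζ.ne_one one_lt_two
  apply (algebraMap L Ω).injective
  rw [map_neg, map_one, h]

include hζ hc hy in
/-- **Automorphisms act on square roots by signs**: `σ(yᵢ) = yᵢ` or `σ(yᵢ) = -yᵢ` for every
`σ ∈ Gal(L(y₁, …, y_k)/L)` (`σ(yᵢ) = ζ^a yᵢ` with `ζ = -1`). [cite: Lang2002, VI §8 (proof of Thm 8.1)] -/
theorem coe_algEquiv_gen_eq_or_eq_neg (σ : kummerField L y ≃ₐ[L] kummerField L y) (i : Fin k) :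
    (σ (gen L y i) : Ω) = y i ∨ (σ (gen L y i) : Ω) = -y i := by
  haveI : NeZero (2 : ℕ) := ⟨two_ne_zero⟩
  have h := algEquiv_apply_gen hζ y c hc hy σ i
  rw [map_neg, map_one] at h
  rcases neg_one_pow_eq_or Ω (expnt hζ y c hc hy σ i).val with h1 | h1
  · left; rw [h, h1, one_mul]
  · right; rw [h, h1, neg_one_mul]

include hζ hc hy in
/-- The sign `εᵢ(σ) = σ(yᵢ)/yᵢ` is `1` or `-1`. [cite: Lang2002, VI §8 (proof of Thm 8.1)] -/
theorem algEquiv_gen_div_eq_one_or (σ : kummerField L y ≃ₐ[L] kummerField L y) (i : Fin k) :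
    (σ (gen L y i) : Ω) / y i = 1 ∨ (σ (gen L y i) : Ω) / y i = -1 := by
  have hy0 := gen_ne_zero_two y c hc hy i
  rcases coe_algEquiv_gen_eq_or_eq_neg hζ y c hc hy σ i with h | h
  · left; rw [h, div_self hy0]
  · right; rw [h, neg_div, div_self hy0]

include hζ hc hy in
/-- `εᵢ(σ)² = 1`. [cite: Lang2002, VI §8 (proof of Thm 8.1)] -/
theorem algEquiv_gen_div_sq (σ : kummerField L y ≃ₐ[L] kummerField L y) (i : Fin k) :
    ((σ (gen L y i) : Ω) / y i) ^ 2 = 1 := by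
  rcases algEquiv_gen_div_eq_one_or hζ y c hc hy σ i with h | h <;> rw [h] <;> norm_num

include hc hy in
/-- `σ(yᵢ) = εᵢ(σ) yᵢ` with `εᵢ(σ) = σ(yᵢ)/yᵢ`. [cite: Lang2002, VI §8 (proof of Thm 8.1)] -/
theorem coe_algEquiv_gen_eq_div_mul (σ : kummerField L y ≃ₐ[L] kummerField L y) (i : Fin k) :
    (σ (gen L y i) : Ω) = (σ (gen L y i) : Ω) / y i * y i := by
  rw [div_mul_cancel₀ _ (gen_ne_zero_two y c hc hy i)]

include hζ hc hy in
/-- The sign `εᵢ(σ)` lies in `L` (it is `±1`): `σ(yᵢ)/yᵢ = algebraMap L Ω (±1)`. [cite: Lang2002, VI §8] -/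
theorem exists_algEquiv_gen_div_eq_algebraMap (σ : kummerField L y ≃ₐ[L] kummerField L y) (i : Fin k) :
    ∃ s : L, (s = 1 ∨ s = -1) ∧ (σ (gen L y i) : Ω) / y i = algebraMap L Ω s := by
  rcases algEquiv_gen_div_eq_one_or hζ y c hc hy σ i with h | h
  · exact ⟨1, Or.inl rfl, by rw [h, map_one]⟩
  · exact ⟨-1, Or.inr rfl, by rw [h, map_neg, map_one]⟩

include hc hy in
/-- `ε(1) = 1`. [cite: Lang2002, VI §8] -/
theorem one_gen_div (i : Fin k) :
    ((1 : kummerField L y ≃ₐ[L] kummerField L y) (gen L y i) : Ω) / y i = 1 := by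
  rw [AlgEquiv.one_apply, coe_gen, div_self (gen_ne_zero_two y c hc hy i)]

include hζ hc hy in
/-- **Multiplicativity of the signs**: `εᵢ(στ) = εᵢ(σ) εᵢ(τ)` (`σ` fixes `εᵢ(τ) = ±1 ∈ L`).
[cite: Lang2002, VI §8 (proof of Thm 8.1: "`a(στ) = a(σ) + a(τ)`")] -/
theorem algEquiv_gen_div_mul (σ τ : kummerField L y ≃ₐ[L] kummerField L y) (i : Fin k) :
    ((σ * τ) (gen L y i) : Ω) / y i = (σ (gen L y i) : Ω) / y i * ((τ (gen L y i) : Ω) / y i) := by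
  have hy0 := gen_ne_zero_two y c hc hy i
  obtain ⟨s, -, hs⟩ := exists_algEquiv_gen_div_eq_algebraMap hζ y c hc hy τ i
  -- `τ (gen i) = s • gen i` inside `E`
  have hτ : τ (gen L y i) = algebraMap L (kummerField L y) s * gen L y i := by
    apply Subtype.ext
    change (τ (gen L y i) : Ω) = algebraMap L Ω s * y i
    rw [← hs, div_mul_cancel₀ _ hy0]
  have h1 : ((σ * τ) (gen L y i) : Ω) = algebraMap L Ω s * (σ (gen L y i) : Ω) := by
    rw [AlgEquiv.mul_apply, hτ, map_mul, AlgEquiv.commutes]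
    rfl
  rw [h1, hs]
  ring

/-! ### Galois transport of polynomial relations -/

/-- Evaluation of an `L`-polynomial at the generators, read in `Ω`, is evaluation at `y`. [folklore] -/
private theorem coe_aeval_gen (f : MvPolynomial (Fin k) L) :
    ((MvPolynomial.aeval (gen L y) f : kummerField L y) : Ω) = MvPolynomial.aeval y f := by
  have h := MvPolynomial.comp_aeval_apply (kummerField L y).val (f := gen L y) f
  exact h

/-- Evaluation at the conjugated generators, read in `Ω`. [folklore] -/
private theorem coe_aeval_algEquiv_gen (σ : kummerField L y ≃ₐ[L] kummerField L y) (f : MvPolynomial (Fin k) L) :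
    ((MvPolynomial.aeval (fun i ↦ σ (gen L y i)) f : kummerField L y) : Ω) =
      MvPolynomial.aeval (fun i ↦ (σ (gen L y i) : Ω)) f := by
  have h := MvPolynomial.comp_aeval_apply (kummerField L y).val (f := fun i ↦ σ (gen L y i)) f
  exact h

/-- **Galois transport of polynomial relations among square roots**: if `f ∈ L[u₁, …, u_k]` vanishes
at `(y₁, …, y_k)` then it vanishes at `(σ(y₁), …, σ(y_k)) = (ε₁(σ) y₁, …, ε_k(σ) y_k)` for every
`σ ∈ Gal(L(y₁, …, y_k)/L)` — Imai: "As `H` is defined over `Q`, `h^σ ∈ H` for all `h ∈ H` and for all `σ`".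
[cite: Imai1976HodgeGroups, §2 Proposition (proof, first case, p. 368)] -/
theorem aeval_algEquiv_gen_eq_zero {f : MvPolynomial (Fin k) L} (hf : MvPolynomial.aeval y f = 0)
    (σ : kummerField L y ≃ₐ[L] kummerField L y) :
    MvPolynomial.aeval (fun i ↦ (σ (gen L y i) : Ω)) f = 0 := by
  have h1 : MvPolynomial.aeval (gen L y) f = 0 := by
    apply Subtype.ext
    rw [coe_aeval_gen, hf]
    rfl
  have h2 : MvPolynomial.aeval (fun i ↦ σ (gen L y i)) f = 0 := by
    have h := MvPolynomial.comp_aeval_apply (σ : kummerField L y →ₐ[L] kummerField L y) (f := gen L y) f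
    simp only [AlgEquiv.coe_toAlgHom] at h
    rw [← h, h1, map_zero]
  rw [← coe_aeval_algEquiv_gen, h2]
  rfl

include hc hy in
/-- Galois transport, sign form: `f(ε₁(σ) y₁, …, ε_k(σ) y_k) = 0`. [cite: Imai1976HodgeGroups, §2 Proposition (proof, first case, p. 368)] -/
theorem aeval_algEquiv_gen_div_mul_eq_zero {f : MvPolynomial (Fin k) L} (hf : MvPolynomial.aeval y f = 0)
    (σ : kummerField L y ≃ₐ[L] kummerField L y) :
    MvPolynomial.aeval (fun i ↦ (σ (gen L y i) : Ω) / y i * y i) f = 0 := by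
  have hfun : (fun i ↦ (σ (gen L y i) : Ω) / y i * y i) = fun i ↦ (σ (gen L y i) : Ω) :=
    funext fun i ↦ div_mul_cancel₀ _ (gen_ne_zero_two y c hc hy i)
  rw [hfun]
  exact aeval_algEquiv_gen_eq_zero y hf σ

/-! ### Finite dimension, and distinctness of the sign characters -/

include hy in
/-- `E = L(y₁, …, y_k)` is finite-dimensional over `L` (each `yᵢ` is a root of `X² - cᵢ`). [cite: Lang2002, VI §8] -/
theorem finiteDimensional_kummerField_two : FiniteDimensional L (kummerField L y) := by
  haveI : Finite (Set.range y) := Set.finite_range y |>.to_subtype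
  refine IntermediateField.finiteDimensional_adjoin ?_
  rintro _ ⟨i, rfl⟩
  refine ⟨Polynomial.X ^ 2 - Polynomial.C (c i), Polynomial.monic_X_pow_sub_C _ two_ne_zero, ?_⟩
  rw [Polynomial.eval₂_sub, Polynomial.eval₂_X_pow, Polynomial.eval₂_C, hy i, sub_self]

include hc hy in
/-- `εᵢ(σ) εⱼ(σ) · yᵢ yⱼ = σ(yᵢ yⱼ)`: the product `yᵢ yⱼ ∈ E` transforms by the product of the signs. [cite: Lang2002, VI §8] -/
theorem coe_algEquiv_gen_mul_gen (σ : kummerField L y ≃ₐ[L] kummerField L y) (i j : Fin k) :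
    (σ (gen L y i * gen L y j) : Ω) =
      (σ (gen L y i) : Ω) / y i * ((σ (gen L y j) : Ω) / y j) * (y i * y j) := by
  have hi := gen_ne_zero_two y c hc hy i
  have hj := gen_ne_zero_two y c hc hy j
  rw [map_mul]
  change (σ (gen L y i) : Ω) * (σ (gen L y j) : Ω) = _
  field_simp

include hζ hc hy in
/-- **Distinctness of the sign characters**: if `yᵢ yⱼ ∉ L` then `εᵢ(σ) ≠ εⱼ(σ)` for some
`σ ∈ Gal(E/L)` — otherwise `σ(yᵢ yⱼ) = εᵢ(σ)² yᵢ yⱼ = yᵢ yⱼ` for all `σ`, and an element of the Galois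
extension `E/L` fixed by the whole Galois group lies in `L`. [cite: Lang2002, VI §1 Thm 1.8 and VI §8 Thm 8.1] -/
theorem exists_algEquiv_gen_div_ne {i j : Fin k} (hij : ∀ q : L, y i * y j ≠ algebraMap L Ω q) :
    ∃ σ : kummerField L y ≃ₐ[L] kummerField L y, (σ (gen L y i) : Ω) / y i ≠ (σ (gen L y j) : Ω) / y j := by
  haveI : NeZero (2 : ℕ) := ⟨two_ne_zero⟩
  haveI := isGalois_kummerField hζ y c hc hy
  haveI := finiteDimensional_kummerField_two y c hy
  by_contra h
  push Not at h
  -- `yᵢ yⱼ` is fixed by every `σ`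
  have hfix : ∀ σ : kummerField L y ≃ₐ[L] kummerField L y, σ (gen L y i * gen L y j) = gen L y i * gen L y j := by
    intro σ
    apply Subtype.ext
    rw [coe_algEquiv_gen_mul_gen y c hc hy σ i j, h σ, ← sq, algEquiv_gen_div_sq hζ y c hc hy σ j, one_mul]
    rfl
  obtain ⟨q, hq⟩ := IntermediateField.mem_bot.1 ((IsGalois.mem_bot_iff_fixed (gen L y i * gen L y j)).2 hfix)
  refine hij q ?_
  have := congrArg (fun x : kummerField L y ↦ (x : Ω)) hq
  simpa using this.symm

include hζ hc hy in
/-- Conversely, if `yᵢ yⱼ ∈ L` then `εᵢ = εⱼ` (`σ` fixes `yᵢ yⱼ`). [cite: Lang2002, VI §8] -/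
theorem algEquiv_gen_div_eq_of_mul_eq {i j : Fin k} {q : L} (hq : y i * y j = algebraMap L Ω q)
    (σ : kummerField L y ≃ₐ[L] kummerField L y) :
    (σ (gen L y i) : Ω) / y i = (σ (gen L y j) : Ω) / y j := by
  have hi := gen_ne_zero_two y c hc hy i
  have hj := gen_ne_zero_two y c hc hy j
  have hprod : gen L y i * gen L y j = algebraMap L (kummerField L y) q := Subtype.ext hq
  have h1 : (σ (gen L y i * gen L y j) : Ω) = y i * y j := by
    rw [hprod, AlgEquiv.commutes, hq]; rfl
  rw [coe_algEquiv_gen_mul_gen y c hc hy σ i j] at h1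
  have h2 : (σ (gen L y i) : Ω) / y i * ((σ (gen L y j) : Ω) / y j) = 1 := by
    have hne : y i * y j ≠ 0 := mul_ne_zero hi hj
    calc (σ (gen L y i) : Ω) / y i * ((σ (gen L y j) : Ω) / y j)
        = (σ (gen L y i) : Ω) / y i * ((σ (gen L y j) : Ω) / y j) * (y i * y j) / (y i * y j) := by
          rw [mul_div_cancel_right₀ _ hne]
      _ = 1 := by rw [h1, div_self hne]
  -- both signs are `±1` with product `1`, hence equal (`-1 ≠ 1` as `-1` is a PRIMITIVE square root)
  have hne := neg_one_ne_one_of_isPrimitiveRoot (Ω := Ω) hζ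
  rcases algEquiv_gen_div_eq_one_or hζ y c hc hy σ i with ha | ha <;>
    rcases algEquiv_gen_div_eq_one_or hζ y c hc hy σ j with hb | hb <;>
    rw [ha, hb] at h2 ⊢ <;> first | rfl | exact absurd (by simpa using h2) hne

include hc hy in
/-- If `yᵢ ∈ L` then `εᵢ = 1`. [cite: Lang2002, VI §8] -/
theorem algEquiv_gen_div_eq_one_of_eq {i : Fin k} {q : L} (hq : y i = algebraMap L Ω q)
    (σ : kummerField L y ≃ₐ[L] kummerField L y) : (σ (gen L y i) : Ω) / y i = 1 := by
  have hi := gen_ne_zero_two y c hc hy i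
  have hgen : gen L y i = algebraMap L (kummerField L y) q := Subtype.ext hq
  rw [hgen, AlgEquiv.commutes]
  change algebraMap L Ω q / y i = 1
  rw [← hq, div_self hi]

/-! ### The spanning lemma -/

include hζ hc hy in
/-- **The sign vectors `ε(σ)`, `σ ∈ Gal(E/L)`, span `Ωᵏ` when the `yᵢ yⱼ` (`i ≠ j`) are irrational over
`L`**: for every `θ : Fin k → Ω` there are coefficients `φ_σ ∈ Ω` with `θᵢ = ∑_σ φ_σ εᵢ(σ)` for all `i`.
Proof: `σ ↦ εᵢ(σ)` are pairwise distinct characters `Gal(E/L) → Ωˣ` (by `exists_algEquiv_gen_div_ne`),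
hence linearly independent functions on `Gal(E/L)` (Dedekind–Artin), so no non-zero linear form on `Ωᵏ`
kills all the vectors `ε(σ)`. [cite: Lang2002, VI §4 Thm 4.1 (independence of characters) and VI §8 Thm 8.1] -/
theorem exists_eq_sum_mul_algEquiv_gen_div
    (hpair : ∀ i j : Fin k, i ≠ j → ∀ q : L, y i * y j ≠ algebraMap L Ω q) (θ : Fin k → Ω) :
    ∃ (s : Finset (kummerField L y ≃ₐ[L] kummerField L y)) (φ : (kummerField L y ≃ₐ[L] kummerField L y) → Ω),
      ∀ i, θ i = ∑ σ ∈ s, φ σ * ((σ (gen L y i) : Ω) / y i) := by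
  classical
  haveI := finiteDimensional_kummerField_two y c hy
  set G := kummerField L y ≃ₐ[L] kummerField L y with hG
  -- the sign characters as monoid homomorphisms `G →* Ω`
  let χ : Fin k → (G →* Ω) := fun i ↦
    { toFun := fun σ ↦ (σ (gen L y i) : Ω) / y i
      map_one' := one_gen_div y c hc hy i
      map_mul' := fun σ τ ↦ algEquiv_gen_div_mul hζ y c hc hy σ τ i }
  have hχ : ∀ i σ, χ i σ = (σ (gen L y i) : Ω) / y i := fun _ _ ↦ rfl
  -- they are pairwise distinct, hence linearly independent as functions `G → Ω`
  have hinj : Function.Injective χ := by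
    intro i j hij
    by_contra hne
    obtain ⟨σ, hσ⟩ := exists_algEquiv_gen_div_ne hζ y c hc hy (hpair i j hne)
    exact hσ (by rw [← hχ, ← hχ, hij])
  have hli : LinearIndependent Ω (fun i ↦ (χ i : G → Ω)) :=
    (linearIndependent_monoidHom G Ω).comp χ hinj
  -- the linear map `φ ↦ (∑_σ φ σ εᵢ(σ))ᵢ` is surjective
  let A : (G → Ω) →ₗ[Ω] (Fin k → Ω) :=
    { toFun := fun φ i ↦ ∑ σ, φ σ * χ i σ
      map_add' := fun φ ψ ↦ by
        funext i; simp only [Pi.add_apply, add_mul, Finset.sum_add_distrib]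
      map_smul' := fun a φ ↦ by
        funext i; simp only [Pi.smul_apply, smul_eq_mul, RingHom.id_apply, Finset.mul_sum, mul_assoc] }
  suffices hA : LinearMap.range A = ⊤ by
    have : θ ∈ LinearMap.range A := hA ▸ Submodule.mem_top
    obtain ⟨φ, hφ⟩ := this
    exact ⟨Finset.univ, φ, fun i ↦ by rw [← hφ]; rfl⟩
  by_contra hne
  obtain ⟨ℓ, hℓ0, hℓ⟩ := Submodule.exists_le_ker_of_lt_top _ (lt_top_iff_ne_top.2 hne)
  -- `ℓ ∘ A = 0`: the coefficients `ℓ(eᵢ)` give a vanishing combination of the characters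
  have hcomb : ∑ i, ℓ (Pi.single i 1) • (χ i : G → Ω) = 0 := by
    funext σ
    simp only [Finset.sum_apply, Pi.smul_apply, smul_eq_mul, Pi.zero_apply]
    have h1 : A (Pi.single σ 1) ∈ LinearMap.ker ℓ := hℓ (LinearMap.mem_range_self A _)
    rw [LinearMap.mem_ker] at h1
    have h2 : A (Pi.single σ 1) = fun i ↦ χ i σ := by
      funext i
      change ∑ τ, (Pi.single σ (1 : Ω) : G → Ω) τ * χ i τ = χ i σ
      simp [Pi.single_apply, Finset.sum_ite_eq', Finset.mem_univ]
    rw [h2] at h1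
    have h3 : (fun i ↦ χ i σ) = ∑ i, χ i σ • (Pi.single i (1 : Ω) : Fin k → Ω) := by
      funext j
      simp [Finset.sum_apply, Pi.single_apply, Finset.sum_ite_eq, Finset.mem_univ]
    rw [h3, map_sum] at h1
    simpa [map_smul, smul_eq_mul, mul_comm] using h1
  have hzero := Fintype.linearIndependent_iff.1 hli (fun i ↦ ℓ (Pi.single i 1)) hcomb
  apply hℓ0
  apply (Pi.basisFun Ω (Fin k)).ext
  intro i
  rw [Pi.basisFun_apply, LinearMap.zero_apply]
  exact hzero i

end Quadratic

/-! ### The case `L = ℚ ⊂ Ω = ℝ` -/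

/-- `-1` is a primitive square root of unity in `ℚ` (characteristic `0 ≠ 2`): the quadratic Kummer theory
above applies to `L = ℚ ⊂ Ω = ℝ` (or `ℂ`). [cite: Lang2002, VI §8 (hypotheses of Thm 8.1, `m = 2`)] -/
theorem Rat.isPrimitiveRoot_neg_one_two : IsPrimitiveRoot (-1 : ℚ) 2 :=
  IsPrimitiveRoot.neg_one 0 (by decide)

end Literature.FieldTheory.Kummer
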